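import Summits.QuantumFields.YangMills.Theorems.BalabanUVNodesN11K1SupportsOffTopFirstStep

/-!
# DAG node N11 ∕ key K1⁹ — THE GENERATION STEP of the off-top support induction ((R3) of the located sentence): blindness, measurability and a.e. POSITIVITY of 11a's
# `𝐓^{(j)} T` along measurable sections of the coarse variables, from the same data for `T` — generic generation with the kernel transport (count-neutral, LOCATED)

HEADER — WORK-UNIT METADATA.  Cell `pub-ymgap`, YM-PLAN Track A (HUMAN RULING D-0062), seat `pub-ymgap-dag-n11-d` (g37; N11 [B14], s2), route `BalabanUVNodes`, item K1⁹ =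
stmt-QuantumFields-27364 (helper lane, `--kind proof --supports 27364 --as helper`, count-neutral).  [III] = [Balaban1988Convergent].  CONSUMED BY NAME, nothing modified: this seat's
O1 `…N11RestrictedAveragingReverseAC` (`margDensity_pos_ae_of_reverseAC`), O2 `…N11K1SupportsOffTopFirstStep` (import cone), g6 `Node00.TkFirstStepRegionVanishing`
(`measurePreserving_restrict_pi`), def-T's 11a `Node00.TkOfRecord` (generic §1: `tkOp`, `genOp`, `vOp`, `zetaOp`, `aOp`, `kernelRT`, `aOp_of_indep`), the disintegration API
`T4AveragingDisintegration` (`jointLaw`, `margDensity`, `condLaw`, `fst_compProd_condLaw`, `jointLaw_fst`, `integrable_jointLaw_iff`, `measurable_graphMap`), Mathlib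
(`measurePreserving_piEquivPiSubtypeProd`, `measurePreserving_piCongrLeft`, `Measure.prod_apply_symm`, `Measure.integrable_compProd_iff`, `Measure.compProd_apply`,
`Kernel.measurable_kernel_prodMk_left`, `StronglyMeasurable.integral_kernel_prod_right'`, `StronglyMeasurable.integral_prod_right'`).

WHY (O2's header, «what remains of `hsupp` is its `k ≥ 1` part»).  The located sentence's last N11-side hypothesis (L ✓p735871 `hsupp`) at a child of length `k+1` is the a.e.
positivity of 11a's `𝐓_{k+1}(s)[Gaussian-bare weights](zero-term operand)` = the ORDERED PRODUCT of `k+1` generations (2.20)–(2.21), each a restricted kernel transport after an A-integral.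
O2 settled one generation.  To thread the argument through the nested generations one needs, per generation `j`, a STEP taking «`T` is measurable, blind to the scale-`j` fluctuation
variables, and POSITIVE a.e. ∕ INTEGRABLE along every measurable zero-fluctuation SECTION of the scale-`j` gauge variables on the V-bond set `sV_j`» to the same for `𝐓^{(j)} T` along
sections of the scale-`(j+1)` variables on ANY finset `S′ ⊇ sV′_j` (the next generation's V-bonds `sV_{j+1} ⊇ sV′_j`, or all bonds at the top).  THIS FILE IS THAT STEP for positivity
(and the blindness ∕ measurability bookkeeping); the L¹-bound step and the induction at the record are the sequel.  The one analytic input is REVERSE a.c. of the generation's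
restricted averaging (O1, a theorem at the record for `N ≥ 2`).

WHAT THIS FILE PROVES (theorems only; 0 `def`, 0 `sorry`; generic lattice `P`, gauge group `G` with Haar datum, standard Borel; fluctuation space `V`).
§1 `tkOp_update_of_fst_eq` (blindness to the fluctuation variables at scales `≥ n` propagates through `tkOp`).
§2 `genOp_update_of_fst_eq` (`𝐓^{(j)}` preserves blindness above its scale) · `measurable_vUpdate` ∕ `measurable_aUpdate` (joint measurability of the V- and A-updates; the
   measurability of `aOp` ∕ `genOp` themselves is CITED from this seat's g9 `…N11TkOpMeasurable` (`measurable_aOp`, `measurable_genOp_kernelRT`), not re-declared).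
§3 (product-Haar plumbing, [folklore]) `measurePreserving_restrict_subfinset` · ★ `measurePreserving_glue` (`Π_S ⊗ Π_{S′∖S} → Π_{S′}`) · ★ `ae_pi_of_forall_compl_ae` («for every complementary
   configuration, a.e. in the sub-configuration» ⇒ «a.e.»).
§4 ★★★ `integral_condLaw_section_pos_ae` — THE CONDITIONAL POSITIVITY: for `T ≥ 0` measurable, positive a.e. and integrable along every section on `sV`, and any measurable zero-fluctuation
   assignment `σ` of configurations to the coarse variables: `Π_{sV′}Haar`-a.e. `z`, `0 < ∫ T((σ z)[V_j|_{sV} := y]) condLaw(z)(dy)` (the joint law is carried by the graph, so the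
   exceptional set is `ν`-null along the section THROUGH THE AVERAGING; disintegration `jointLaw = avg_*ν ⊗ condLaw`; integrability descends by `integrable_compProd_iff`; reverse a.c.
   transfers `avg_*ν`-a.e. to `Π Haar`-a.e.).
§5 ★★★ `genOp_section_pos_ae` — THE STEP: for `D = ⟨sV, sV′, kernelRT avg, 1, sA, w⟩` with reverse a.c. and an A-weight whose fibre integral is a positive constant `c₀` at zero scale-`j`
   fluctuation, and `T` as above (+ blind at scale `j`): `genOp j D T` is POSITIVE a.e. along every measurable zero-fluctuation section of the scale-`(j+1)` variables on any `S′ ⊇ sV′`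
   reading the section parameter on `sV′` (`genOp = margDensity(π z)·c₀·∫ T dcondLaw(π z)` by `aOp_of_indep`; (i) O1 pulled back along the restriction `π`; (ii) §4 at the glued
   sections for every complementary configuration, assembled by §3).

HONEST FRAMING.  [folklore] measure theory (product measures, Fubini, disintegration, kernel integrals) about the published formula (2.21) [III] over landed definitions; the cites are
LOCATORS; nothing of Bałaban's estimates asserted or refuted; no K1⁹ witness; N11 NOT discharged; K1⁹ NOT closed; counts unmoved (typed 28∕28 · discharged 8∕27 = 8∕28 incl. NODE O).
One finite four-torus programme at fixed `ε = L^{−K}`; NOT ℝ⁴, NOT OS, NOT a mass gap, NOT Clay.  No `sorry`, `axiom`, `def`, `instance`, `notation`.  Sources (locators): [III] (2.18)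
p.257, (2.20)–(2.22) p.258, (3.24) p.270; [Balaban1985Averaging] (10) p.19.
-/

noncomputable section

open MeasureTheory Function ProbabilityTheory
open scoped BigOperators ENNReal NNReal

namespace Summit.QuantumFields.YangMills.Theorems.BalabanUVNodesN11OffTopSupportsGenerationStep

open Literature.MathematicalPhysics.QuantumFieldTheory.Balaban1983to89 T4Continuum T4AveragingDisintegration
open T4AdjointCovariance (insA JCfg)
open T4NestedCovariance (Op)
open Node00 Node00.Tk
open BalabanUVNodesN11RestrictedAveragingReverseAC (margDensity_pos_ae_of_reverseAC)

universe u

/-! ## §1  Fluctuation-blindness above the working scale propagates through `tkOp`; joint measurability of the configuration updates -/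

section Blind

variable {P : Params} {G : Type u} {V : Type u}

/-- **BLINDNESS TO THE FLUCTUATION VARIABLES AT SCALES `≥ n` PROPAGATES THROUGH THE ORDERED PRODUCT `𝐓_n`**: if every generation `gen i` (`i < n`) maps functions blind to the
scale-`m` fluctuation variables (`m > i`) to functions blind to them, and `F` is blind at every scale `≥ n₀`, then `tkOp gen n F` is blind at every scale `m` with `n ≤ m` and `n₀ ≤ m`.
[cite: Balaban1988Convergent, (2.20)–(2.21) p.258 (bookkeeping)] -/
theorem tkOp_update_of_fst_eq (gen : ℕ → Op (MultiCfg P G V) ℝ)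
    (hgen : ∀ i (F : MultiCfg P G V → ℝ) m, i < m → (∀ ω (c : JCfg P m G V), c.1 = (ω m).1 → F (Function.update ω m c) = F ω) →
      ∀ ω (c : JCfg P m G V), c.1 = (ω m).1 → gen i F (Function.update ω m c) = gen i F ω)
    (F : MultiCfg P G V → ℝ) (n₀ : ℕ) (hF : ∀ m, n₀ ≤ m → ∀ ω (c : JCfg P m G V), c.1 = (ω m).1 → F (Function.update ω m c) = F ω) :
    ∀ n m, n ≤ m → n₀ ≤ m → ∀ ω (c : JCfg P m G V), c.1 = (ω m).1 → tkOp gen n F (Function.update ω m c) = tkOp gen n F ω := by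
  intro n
  induction n with
  | zero => exact fun m _ h0 ω c hc => hF m h0 ω c hc
  | succ n ih =>
    intro m hnm h0 ω c hc
    rw [tkOp_succ]
    exact hgen n _ m (by omega) (fun ω' c' hc' => ih m (by omega) h0 ω' c' hc') ω c hc

end Blind

/-! ## §2  One generation with a kernel transport: blindness, measurability, the A-normaliser -/

section Generation

variable {P : Params} {G : Type u} {V : Type u}
variable [GaugeGroup G] [MeasurableSpace G] [HaarData G] [StandardBorelSpace G]
variable [NormedAddCommGroup V] [InnerProductSpace ℝ V] [FiniteDimensional ℝ V] [MeasurableSpace V] [BorelSpace V]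

omit [GaugeGroup G] [MeasurableSpace G] [HaarData G] [StandardBorelSpace G] in
/-- **THE GENERATION `𝐓^{(j)}` PRESERVES BLINDNESS ABOVE ITS SCALE**: for `m > j`, if the weights `ζ`, `w` and the operand `F` do not read the scale-`m` fluctuation variables, neither does
`genOp j D F` (the V-factor reads `(ω (j+1)).1` only). [cite: Balaban1988Convergent, (2.21) p.258 (bookkeeping)] -/
theorem genOp_update_of_fst_eq (j : ℕ) [DecidableEq (PBond P j)] (D : GenData P G V j) {m : ℕ} (hm : j < m)
    (hζ : ∀ ω (c : JCfg P m G V), c.1 = (ω m).1 → D.ζ (Function.update ω m c) = D.ζ ω)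
    (hw : ∀ ω (c : JCfg P m G V), c.1 = (ω m).1 → D.w (Function.update ω m c) = D.w ω)
    (F : MultiCfg P G V → ℝ) (hF : ∀ ω (c : JCfg P m G V), c.1 = (ω m).1 → F (Function.update ω m c) = F ω)
    (ω : MultiCfg P G V) (c : JCfg P m G V) (hc : c.1 = (ω m).1) :
    genOp j D F (Function.update ω m c) = genOp j D F ω := by
  have hjm : j ≠ m := Nat.ne_of_lt hm
  rw [genOp_apply, vOp_apply, vOp_apply]
  have h1 : (fun b : ↥D.sV' => ((Function.update ω m c) (j + 1)).1 b) = fun b : ↥D.sV' => (ω (j + 1)).1 b := by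
    funext b
    by_cases h : j + 1 = m
    · subst h; rw [Function.update_self, hc]
    · rw [Function.update_of_ne h]
  rw [h1]
  congr 1
  funext y
  rw [Function.update_of_ne hjm]
  have hcomm : Function.update (Function.update ω m c) j (Function.updateFinset (ω j).1 D.sV y, (ω j).2) =
      Function.update (Function.update ω j (Function.updateFinset (ω j).1 D.sV y, (ω j).2)) m c :=
    Function.update_comm (Ne.symm hjm) _ _ _
  rw [hcomm, zetaOp_apply, zetaOp_apply]
  have hc' : c.1 = ((Function.update ω j (Function.updateFinset (ω j).1 D.sV y, (ω j).2)) m).1 := by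
    rw [Function.update_of_ne (Ne.symm hjm)]; exact hc
  rw [hζ _ c hc']
  congr 1
  rw [aOp_apply, aOp_apply]
  refine integral_congr_ae (Filter.Eventually.of_forall fun a => ?_)
  set ω₁ := Function.update ω j (Function.updateFinset (ω j).1 D.sV y, (ω j).2) with hω₁
  have hj1 : (Function.update ω₁ m c) j = ω₁ j := Function.update_of_ne hjm _ _
  rw [hj1]
  have hcomm2 : Function.update (Function.update ω₁ m c) j (insA D.sA a (ω₁ j)) = Function.update (Function.update ω₁ j (insA D.sA a (ω₁ j))) m c :=
    Function.update_comm (Ne.symm hjm) _ _ _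
  have hc'' : c.1 = ((Function.update ω₁ j (insA D.sA a (ω₁ j))) m).1 := by
    rw [Function.update_of_ne (Ne.symm hjm)]; exact hc'
  beta_reduce
  rw [hcomm2, hw _ c hc'', hF _ c hc'']

omit [GaugeGroup G] [HaarData G] [StandardBorelSpace G] [NormedAddCommGroup V] [InnerProductSpace ℝ V] [FiniteDimensional ℝ V] [BorelSpace V] in
/-- Joint measurability of the V-update `(ω, y) ↦ ω[V_j|_{sV} := y]` of the V-factor. [cite: Balaban1988Convergent, (2.21) p.258 (bookkeeping)] -/
theorem measurable_vUpdate (j : ℕ) [DecidableEq (PBond P j)] (sV : Finset (PBond P j)) :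
    Measurable fun p : MultiCfg P G V × (↥sV → G) => Function.update p.1 j (Function.updateFinset (p.1 j).1 sV p.2, (p.1 j).2) := by
  refine measurable_update'.comp (measurable_fst.prodMk ?_)
  exact (measurable_updateFinset'.comp (((measurable_pi_apply j).comp measurable_fst).fst.prodMk measurable_snd)).prodMk
    ((measurable_pi_apply j).comp measurable_fst).snd

omit [GaugeGroup G] [HaarData G] [StandardBorelSpace G] [NormedAddCommGroup V] [InnerProductSpace ℝ V] [FiniteDimensional ℝ V] [BorelSpace V] in
/-- Joint measurability of the A-update `(ω, a) ↦ ω[A_j|_{sA} := a]` of the A-factor. [cite: Balaban1988Convergent, (2.21) p.258 (bookkeeping)] -/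
theorem measurable_aUpdate (j : ℕ) [DecidableEq (PBond P j)] (sA : Finset (PBond P j)) :
    Measurable fun p : MultiCfg P G V × (↥sA → V) => Function.update p.1 j (insA sA p.2 (p.1 j)) := by
  refine measurable_update'.comp (measurable_fst.prodMk ?_)
  exact ((measurable_pi_apply j).comp measurable_fst).fst.prodMk
    (measurable_updateFinset'.comp (((measurable_pi_apply j).comp measurable_fst).snd.prodMk measurable_snd))

end Generation

/-! ## §3  Product-Haar plumbing: sub-finset restrictions and the glue of a sub-finset configuration with the complementary variables are measure preserving;
«for every complement, a.e. in the sub-configuration» ⇒ «a.e.» -/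

section Plumbing

variable {ι : Type*} [Fintype ι] [DecidableEq ι] {G : Type u} [GaugeGroup G] [MeasurableSpace G] [HaarData G]

/-- **RESTRICTION TO A SUB-FINSET PUSHES PRODUCT HAAR TO PRODUCT HAAR** (both restrictions from the full configuration do, and the small one factors through the big one).
[cite: Balaban1985Averaging, (10) p.19 (bookkeeping)] -/
theorem measurePreserving_restrict_subfinset {S S' : Finset ι} (h : S ⊆ S') :
    MeasurePreserving (fun (z : ↥S' → G) (b : ↥S) => z ⟨b.1, h b.2⟩) (Measure.pi fun _ : ↥S' => (HaarData.haar : Measure G))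
      (Measure.pi fun _ : ↥S => (HaarData.haar : Measure G)) := by
  have hS' := measurePreserving_restrict_pi (G := G) (ι := ι) S'
  have hS := measurePreserving_restrict_pi (G := G) (ι := ι) S
  have hmeas : Measurable (fun (z : ↥S' → G) (b : ↥S) => z ⟨b.1, h b.2⟩) := measurable_pi_lambda _ fun b => measurable_pi_apply _
  refine ⟨hmeas, ?_⟩
  have hcomp : (fun (f : ι → G) (b : ↥S) => f b) = (fun (z : ↥S' → G) (b : ↥S) => z ⟨b.1, h b.2⟩) ∘ (fun (f : ι → G) (b : ↥S') => f b) := rfl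
  rw [← hS'.map_eq, Measure.map_map hmeas hS'.measurable, ← hcomp, hS.map_eq]

omit [Fintype ι] in
/-- **THE GLUE OF A SUB-CONFIGURATION WITH THE COMPLEMENTARY VARIABLES IS MEASURE PRESERVING** from `Π_S Haar ⊗ Π_{S′∖S} Haar` to `Π_{S′} Haar` (Mathlib's `piEquivPiSubtypeProd` after the
reindexing `S ≃ {b ∈ S′ | b ∈ S}`). [cite: Balaban1985Averaging, (10) p.19 (bookkeeping)] -/
theorem measurePreserving_glue {S S' : Finset ι} (h : S ⊆ S') :
    MeasurePreserving (fun q : (↥S → G) × ({b : ↥S' // (b : ι) ∉ S} → G) => fun b : ↥S' => if hb : (b : ι) ∈ S then q.1 ⟨b.1, hb⟩ else q.2 ⟨b, hb⟩)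
      ((Measure.pi fun _ : ↥S => (HaarData.haar : Measure G)).prod (Measure.pi fun _ : {b : ↥S' // (b : ι) ∉ S} => (HaarData.haar : Measure G)))
      (Measure.pi fun _ : ↥S' => (HaarData.haar : Measure G)) := by
  classical
  let f : ↥S ≃ {b : ↥S' // (b : ι) ∈ S} := ⟨fun b => ⟨⟨b.1, h b.2⟩, b.2⟩, fun b => ⟨b.1.1, b.2⟩, fun _ => rfl, fun _ => rfl⟩
  have hf := measurePreserving_piCongrLeft (fun _ : {b : ↥S' // (b : ι) ∈ S} => (HaarData.haar : Measure G)) f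
  have he := (measurePreserving_piEquivPiSubtypeProd (fun _ : ↥S' => (HaarData.haar : Measure G)) (fun b : ↥S' => (b : ι) ∈ S)).symm _
  have hcomp := he.comp (hf.prod (MeasurePreserving.id (Measure.pi fun _ : {b : ↥S' // (b : ι) ∉ S} => (HaarData.haar : Measure G))))
  have hfun : (fun q : (↥S → G) × ({b : ↥S' // (b : ι) ∉ S} → G) => fun b : ↥S' => if hb : (b : ι) ∈ S then q.1 ⟨b.1, hb⟩ else q.2 ⟨b, hb⟩) =
      ⇑(MeasurableEquiv.piEquivPiSubtypeProd (fun _ : ↥S' => G) (fun b : ↥S' => (b : ι) ∈ S)).symm ∘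
        Prod.map (⇑(MeasurableEquiv.piCongrLeft (fun _ : {b : ↥S' // (b : ι) ∈ S} => G) f)) id := by
    funext q b
    simp only [Function.comp_apply, MeasurableEquiv.piEquivPiSubtypeProd, MeasurableEquiv.symm_mk, MeasurableEquiv.coe_mk,
      Equiv.piEquivPiSubtypeProd_symm_apply, MeasurableEquiv.coe_piCongrLeft]
    split_ifs with hb
    · exact (Equiv.piCongrLeft_apply_apply (P := fun _ : {b : ↥S' // (b : ι) ∈ S} => G) f q.1 ⟨b.1, hb⟩).symm
    · rfl
  rw [hfun]
  exact hcomp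

omit [Fintype ι] in
/-- **«FOR EVERY COMPLEMENTARY CONFIGURATION, a.e. IN THE SUB-CONFIGURATION» ⇒ «a.e.»** (the glue is measure preserving; Fubini through `Measure.prod_apply_symm`).
[cite: Balaban1985Averaging, (10) p.19 (bookkeeping)] -/
theorem ae_pi_of_forall_compl_ae {S S' : Finset ι} (h : S ⊆ S') {Q : (↥S' → G) → Prop} (hQ : MeasurableSet {z | Q z})
    (hae : ∀ z₂ : {b : ↥S' // (b : ι) ∉ S} → G, ∀ᵐ z₁ ∂(Measure.pi fun _ : ↥S => (HaarData.haar : Measure G)),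
      Q (fun b : ↥S' => if hb : (b : ι) ∈ S then z₁ ⟨b.1, hb⟩ else z₂ ⟨b, hb⟩)) :
    ∀ᵐ z ∂(Measure.pi fun _ : ↥S' => (HaarData.haar : Measure G)), Q z := by
  have hg := measurePreserving_glue (G := G) h
  rw [← hg.map_eq]
  refine (ae_map_iff hg.measurable.aemeasurable hQ).2 ?_
  have hQ' : MeasurableSet {q : (↥S → G) × ({b : ↥S' // (b : ι) ∉ S} → G) |
      ¬ Q (fun b : ↥S' => if hb : (b : ι) ∈ S then q.1 ⟨b.1, hb⟩ else q.2 ⟨b, hb⟩)} := (hQ.preimage hg.measurable).compl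
  rw [ae_iff, Measure.prod_apply_symm hQ']
  refine (lintegral_eq_zero_iff (measurable_measure_prodMk_right hQ')).2 (Filter.Eventually.of_forall fun z₂ => ?_)
  exact ae_iff.1 (hae z₂)

end Plumbing

/-! ## §4  THE CONDITIONAL POSITIVITY: a.e. in the coarse variables, the conditional law of the restricted averaging integrates a nonnegative integrand that is positive a.e.
along every section of the fine variables to a POSITIVE number (joint law carried by the graph; reverse a.c. transfers the null set) -/

section Conditional

variable {P : Params} {G : Type u} {V : Type u}
variable [GaugeGroup G] [MeasurableSpace G] [HaarData G] [StandardBorelSpace G]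
variable [NormedAddCommGroup V] [InnerProductSpace ℝ V] [FiniteDimensional ℝ V] [MeasurableSpace V] [BorelSpace V]

omit [InnerProductSpace ℝ V] [FiniteDimensional ℝ V] [BorelSpace V] in
/-- **CONDITIONAL POSITIVITY ALONG A SECTION.**  Let `T ≥ 0` be measurable on the all-scales configuration, POSITIVE a.e. and INTEGRABLE along every measurable section of the scale-`j`
variables on `sV` with vanishing fluctuation variables.  Then for every measurable assignment `σ` of a zero-fluctuation configuration to the coarse variables `z` on `sV′`, for
`Π_{sV′}Haar`-a.e. `z` the conditional law of the restricted averaging at `z` integrates `y ↦ T((σ z)[V_j|_{sV} := y])` to a POSITIVE number — given REVERSE a.c. of the averaging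
(O1).  MECHANISM: the joint law of `(avg y, y)` is carried by the graph, so the exceptional set has joint measure `ν{y | T((σ (avg y))[… := y]) ≤ 0} = 0` (the hypothesis at the section
through the averaging); disintegration `jointLaw = (avg_*ν) ⊗ condLaw` makes the `condLaw z`-sections null for `avg_*ν`-a.e. `z`, integrability along the same section descends to
`condLaw z` (`integrable_compProd_iff`), and `Π Haar ≪ avg_*ν` transfers both to `Π Haar`-a.e. `z`. [cite: Balaban1988Convergent, (2.21) p.258; Balaban1985Averaging, (10) p.19 (bookkeeping)] -/
theorem integral_condLaw_section_pos_ae (j : ℕ) [DecidableEq (PBond P j)] (sV : Finset (PBond P j)) (sV' : Finset (PBond P (j + 1)))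
    {avg : (↥sV → G) → (↥sV' → G)} (havg : Measurable avg)
    (hrev : (Measure.pi fun _ : ↥sV' => (HaarData.haar : Measure G)) ≪ (Measure.pi fun _ : ↥sV => (HaarData.haar : Measure G)).map avg)
    {T : MultiCfg P G V → ℝ} (hT0 : ∀ ω, 0 ≤ T ω) (hTm : Measurable T)
    (hTpos : ∀ c : (↥sV → G) → MultiCfg P G V, Measurable c → (∀ y (b : ↥sV), ((c y) j).1 b = y b) → (∀ y i, ((c y) i).2 = 0) →
      ∀ᵐ y ∂(Measure.pi fun _ : ↥sV => (HaarData.haar : Measure G)), 0 < T (c y))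
    (hTint : ∀ c : (↥sV → G) → MultiCfg P G V, Measurable c → (∀ y (b : ↥sV), ((c y) j).1 b = y b) → (∀ y i, ((c y) i).2 = 0) →
      Integrable (fun y => T (c y)) (Measure.pi fun _ : ↥sV => (HaarData.haar : Measure G)))
    (σ : (↥sV' → G) → MultiCfg P G V) (hσ : Measurable σ) (hσz : ∀ z i, ((σ z) i).2 = 0) :
    ∀ᵐ z ∂(Measure.pi fun _ : ↥sV' => (HaarData.haar : Measure G)),
      0 < ∫ y, T (Function.update (σ z) j (Function.updateFinset ((σ z) j).1 sV y, ((σ z) j).2))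
        ∂(condLaw (Measure.pi fun _ : ↥sV => (HaarData.haar : Measure G)) avg z) := by
  set ν : Measure (↥sV → G) := Measure.pi fun _ : ↥sV => (HaarData.haar : Measure G) with hν
  set g : (↥sV' → G) × (↥sV → G) → ℝ := fun q => T (Function.update (σ q.1) j (Function.updateFinset ((σ q.1) j).1 sV q.2, ((σ q.1) j).2)) with hg
  have hgm : Measurable g := hTm.comp ((measurable_vUpdate (G := G) (V := V) j sV).comp ((hσ.comp measurable_fst).prodMk measurable_snd))
  have hcν : Measurable fun y : ↥sV → G => Function.update (σ (avg y)) j (Function.updateFinset ((σ (avg y)) j).1 sV y, ((σ (avg y)) j).2) :=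
    (measurable_vUpdate (G := G) (V := V) j sV).comp ((hσ.comp havg).prodMk measurable_id)
  have hcνr : ∀ (y : ↥sV → G) (b : ↥sV), ((Function.update (σ (avg y)) j (Function.updateFinset ((σ (avg y)) j).1 sV y, ((σ (avg y)) j).2)) j).1 b = y b :=
    fun y b => by rw [Function.update_self]; simp only [Function.updateFinset_def, dif_pos b.2]
  have hcνz : ∀ (y : ↥sV → G) i, ((Function.update (σ (avg y)) j (Function.updateFinset ((σ (avg y)) j).1 sV y, ((σ (avg y)) j).2)) i).2 = 0 := fun y i => by
    by_cases hi : i = j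
    · subst hi; rw [Function.update_self]; exact hσz _ _
    · rw [Function.update_of_ne hi]; exact hσz _ _
  have hpos := hTpos _ hcν hcνr hcνz
  have hint := hTint _ hcν hcνr hcνz
  have hgi : Integrable g (jointLaw ν avg) := (integrable_jointLaw_iff ν havg hgm.aestronglyMeasurable).2 hint
  rw [← fst_compProd_condLaw ν avg] at hgi
  have h1 := (Measure.integrable_compProd_iff hgm.aestronglyMeasurable).1 hgi
  have hA : MeasurableSet {q : (↥sV' → G) × (↥sV → G) | g q ≤ 0} := measurableSet_le hgm measurable_const
  have hA0 : jointLaw ν avg {q | g q ≤ 0} = 0 := by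
    rw [jointLaw, Measure.map_apply (measurable_graphMap havg) hA]
    exact measure_eq_zero_iff_ae_notMem.2 (hpos.mono fun y hy => show ¬ g (avg y, y) ≤ 0 from not_le.2 hy)
  rw [← fst_compProd_condLaw ν avg, Measure.compProd_apply hA] at hA0
  have h2 : ∀ᵐ z ∂(jointLaw ν avg).fst, condLaw ν avg z (Prod.mk z ⁻¹' {q | g q ≤ 0}) = 0 :=
    (lintegral_eq_zero_iff (Kernel.measurable_kernel_prodMk_left hA)).1 hA0
  rw [jointLaw_fst ν havg] at h1 h2
  filter_upwards [hrev.ae_le h1.1, hrev.ae_le h2] with z hz1 hz2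
  refine (integral_pos_iff_support_of_nonneg_ae (Filter.Eventually.of_forall fun y => hT0 _) hz1).2 ?_
  have hfull : condLaw ν avg z (Prod.mk z ⁻¹' {q | g q ≤ 0})ᶜ = 1 := (prob_compl_eq_one_iff (hA.preimage measurable_prodMk_left)).2 hz2
  refine lt_of_lt_of_le (zero_lt_one.trans_eq hfull.symm) (measure_mono fun y hy => ?_)
  rw [Function.mem_support]
  exact (not_le.1 (show ¬ g (z, y) ≤ 0 from hy)).ne'

end Conditional

/-! ## §5  THE GENERATION STEP FOR POSITIVITY: a.e. along every section of the coarse variables over any superset of the image bonds -/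

section Step

variable {P : Params} {G : Type u} {V : Type u}
variable [GaugeGroup G] [MeasurableSpace G] [HaarData G] [StandardBorelSpace G]
variable [NormedAddCommGroup V] [InnerProductSpace ℝ V] [FiniteDimensional ℝ V] [MeasurableSpace V] [BorelSpace V]

/-- ★★★ **THE GENERATION STEP (POSITIVITY).**  Data: a generation `D = ⟨sV, sV′, kernelRT avg, 1, sA, w⟩` with measurable restricted averaging `avg`, REVERSE a.c. `Π_{sV′}Haar ≪ avg_*Π_{sV}Haar`,
and an A-weight whose fibre integral is the positive constant `c₀` at every configuration with vanishing scale-`j` fluctuation variables; an operand `T ≥ 0`, measurable, blind to the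
scale-`j` fluctuation variables, POSITIVE a.e. and INTEGRABLE along every measurable zero-fluctuation section of the scale-`j` variables on `sV`.  THEN `genOp j D T` is POSITIVE a.e. along
every measurable zero-fluctuation section of the scale-`(j+1)` variables on any `S′ ⊇ sV′`.  [cite: Balaban1988Convergent, (2.20)–(2.22) p.258 (bookkeeping)] -/
theorem genOp_section_pos_ae (j : ℕ) [DecidableEq (PBond P j)] [DecidableEq (PBond P (j + 1))] (sV : Finset (PBond P j)) (sV' : Finset (PBond P (j + 1)))
    {avg : (↥sV → G) → (↥sV' → G)} (havg : Measurable avg)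
    (hrev : (Measure.pi fun _ : ↥sV' => (HaarData.haar : Measure G)) ≪ (Measure.pi fun _ : ↥sV => (HaarData.haar : Measure G)).map avg)
    (sA : Finset (PBond P j)) (w : MultiCfg P G V → ℝ) {c₀ : ℝ} (hc₀ : 0 < c₀)
    (hwN : ∀ ω : MultiCfg P G V, (ω j).2 = 0 → ∫ a, w (Function.update ω j (insA sA a (ω j))) ∂(Measure.pi fun _ : ↥sA => (volume : Measure V)) = c₀)
    {T : MultiCfg P G V → ℝ} (hT0 : ∀ ω, 0 ≤ T ω) (hTm : Measurable T) (hTfl : ∀ ω (c : JCfg P j G V), c.1 = (ω j).1 → T (Function.update ω j c) = T ω)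
    (hTpos : ∀ c : (↥sV → G) → MultiCfg P G V, Measurable c → (∀ y (b : ↥sV), ((c y) j).1 b = y b) → (∀ y i, ((c y) i).2 = 0) →
      ∀ᵐ y ∂(Measure.pi fun _ : ↥sV => (HaarData.haar : Measure G)), 0 < T (c y))
    (hTint : ∀ c : (↥sV → G) → MultiCfg P G V, Measurable c → (∀ y (b : ↥sV), ((c y) j).1 b = y b) → (∀ y i, ((c y) i).2 = 0) →
      Integrable (fun y => T (c y)) (Measure.pi fun _ : ↥sV => (HaarData.haar : Measure G)))
    (S' : Finset (PBond P (j + 1))) (hS' : sV' ⊆ S') (c : (↥S' → G) → MultiCfg P G V) (hc : Measurable c)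
    (hcr : ∀ z (b : PBond P (j + 1)) (hb : b ∈ sV'), ((c z) (j + 1)).1 b = z ⟨b, hS' hb⟩) (hcz : ∀ z i, ((c z) i).2 = 0) :
    ∀ᵐ z ∂(Measure.pi fun _ : ↥S' => (HaarData.haar : Measure G)), 0 < genOp j ⟨sV, sV', kernelRT avg, fun _ => 1, sA, w⟩ T (c z) := by
  set ν : Measure (↥sV → G) := Measure.pi fun _ : ↥sV => (HaarData.haar : Measure G) with hν
  set μ : Measure (↥sV' → G) := Measure.pi fun _ : ↥sV' => (HaarData.haar : Measure G) with hμ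
  set π : (↥S' → G) → (↥sV' → G) := fun z b => z ⟨b.1, hS' b.2⟩ with hπ
  have hπm : MeasurePreserving π (Measure.pi fun _ : ↥S' => (HaarData.haar : Measure G)) μ := measurePreserving_restrict_subfinset (G := G) hS'
  have hread : ∀ z, (fun b : ↥sV' => ((c z) (j + 1)).1 b) = π z := fun z => funext fun b => hcr z b.1 b.2
  have hgen : ∀ z, genOp j ⟨sV, sV', kernelRT avg, fun _ => 1, sA, w⟩ T (c z) =
      (margDensity ν μ avg (π z) : ℝ) * (c₀ * ∫ y, T (Function.update (c z) j (Function.updateFinset ((c z) j).1 sV y, ((c z) j).2)) ∂(condLaw ν avg (π z))) := by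
    intro z
    rw [genOp_apply, vOp_apply]
    show kernelRT avg _ _ = _
    rw [hread z, kernelRT_apply, ← integral_const_mul c₀]
    congr 1
    refine integral_congr_ae (Filter.Eventually.of_forall fun y => ?_)
    set ω := Function.update (c z) j (Function.updateFinset ((c z) j).1 sV y, ((c z) j).2) with hω
    have hω0 : (ω j).2 = 0 := by rw [hω, Function.update_self]; exact hcz z j
    show (1 : ℝ) * aOp j sA w T ω = c₀ * T ω
    rw [one_mul, aOp_of_indep j sA w T ω (fun a => hTfl ω _ rfl), hwN ω hω0]
  simp_rw [hgen]
  have h1 : ∀ᵐ z ∂(Measure.pi fun _ : ↥S' => (HaarData.haar : Measure G)), 0 < (margDensity ν μ avg (π z) : ℝ) := by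
    have h : ∀ᵐ z' ∂(Measure.pi fun _ : ↥S' => (HaarData.haar : Measure G)).map π, 0 < (margDensity ν μ avg z' : ℝ) := by
      rw [hπm.map_eq]
      exact margDensity_pos_ae_of_reverseAC ν μ havg hrev
    exact ae_of_ae_map hπm.measurable.aemeasurable h
  have h2 : ∀ᵐ z ∂(Measure.pi fun _ : ↥S' => (HaarData.haar : Measure G)),
      0 < ∫ y, T (Function.update (c z) j (Function.updateFinset ((c z) j).1 sV y, ((c z) j).2)) ∂(condLaw ν avg (π z)) := by
    have hmeas : MeasurableSet {z : ↥S' → G | 0 < ∫ y, T (Function.update (c z) j (Function.updateFinset ((c z) j).1 sV y, ((c z) j).2)) ∂(condLaw ν avg (π z))} := by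
      have hI : Measurable fun p : (↥S' → G) × (↥sV → G) => T (Function.update (c p.1) j (Function.updateFinset ((c p.1) j).1 sV p.2, ((c p.1) j).2)) :=
        hTm.comp ((measurable_vUpdate (G := G) (V := V) j sV).comp ((hc.comp measurable_fst).prodMk measurable_snd))
      have hκ := hI.stronglyMeasurable.integral_kernel_prod_right' (κ := (condLaw ν avg).comap π hπm.measurable)
      exact measurableSet_lt measurable_const hκ.measurable
    refine ae_pi_of_forall_compl_ae (G := G) hS' hmeas fun z₂ => ?_
    set σ : (↥sV' → G) → MultiCfg P G V := fun z₁ => c (fun b : ↥S' => if hb : (b : PBond P (j + 1)) ∈ sV' then z₁ ⟨b.1, hb⟩ else z₂ ⟨b, hb⟩) with hσ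
    have hglue : Measurable fun z₁ : ↥sV' → G => fun b : ↥S' => if hb : (b : PBond P (j + 1)) ∈ sV' then z₁ ⟨b.1, hb⟩ else z₂ ⟨b, hb⟩ := by
      refine measurable_pi_lambda _ fun b => ?_
      by_cases hb : (b : PBond P (j + 1)) ∈ sV'
      · simp only [hb, dif_pos]; exact measurable_pi_apply _
      · simp only [hb, dif_neg, not_false_eq_true]; exact measurable_const
    have hσm : Measurable σ := hc.comp hglue
    have hσz : ∀ z₁ i, ((σ z₁) i).2 = 0 := fun z₁ i => hcz _ i
    have hπσ : ∀ z₁, π (fun b : ↥S' => if hb : (b : PBond P (j + 1)) ∈ sV' then z₁ ⟨b.1, hb⟩ else z₂ ⟨b, hb⟩) = z₁ := fun z₁ => by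
      funext b; show (if hb : ((⟨b.1, hS' b.2⟩ : ↥S') : PBond P (j + 1)) ∈ sV' then z₁ ⟨b.1, hb⟩ else _) = z₁ b; rw [dif_pos b.2]
    have h := integral_condLaw_section_pos_ae (G := G) (V := V) j sV sV' havg hrev hT0 hTm hTpos hTint σ hσm hσz
    filter_upwards [h] with z₁ hz₁
    rw [hπσ z₁]
    simpa only [hσ] using hz₁
  filter_upwards [h1, h2] with z hz1 hz2
  exact mul_pos hz1 (mul_pos hc₀ hz2)

end Step

end Summit.QuantumFields.YangMills.Theorems.BalabanUVNodesN11OffTopSupportsGenerationStep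

end
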